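import Summits.QuantumFields.YangMills.Theorems.BalabanUVNodesPortS1G3CPointSteps
import Summits.QuantumFields.YangMills.Theorems.BalabanUVNodesPortS1G3CPoint
import Summits.QuantumFields.YangMills.Theorems.BalabanUVNodesPortS1G3CStickOut

/-!
# NODE O port PT-A — `stub_G3C` (repaired edition `G3CAtRecordL`), layer (β): THE WALK-SUM COMBINATORICS — the per-step weight, the rate extraction
# `Π_i e^{−δ₀ d_j(Y_i)} ≤ e^{κt·9^d}·e^{−κt·d_j(X)}·Π_i e^{κt(d_j(Y_i)+9^d+3)}·…`, the path-sum lemma `Σ_w Π_i f(□_{i−1}; w_i) ≤ Λ^m`, and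
# `Σ_{(□₀,w): X(□₀,w) = X} |t(□₀,w)| ≤ (N_□/γ)·e^{κt·9^d}·#X·e^{−κt·d_j(X)}·Λ^m` AT A PAIR satisfying the point predicate `G3CPt … X φ`

Cell `ym-nodeO-ideate`, porter hand `hand-27930-G3C` (g1); `--supports stmt-QuantumFields-27930`; count-neutral.  [16] = [Balaban1985UV3], [B9] = [Balaban1985BackgroundPropagators],
[I] = [Balaban1987RG1], [II] = [Balaban1988RG2Cluster].

WHY (memo §5c, row (g3) «THE MAJORANT»; [16] (23)→(25) p.262 «Summing the expressions with the same localization X»).  A walk `(□₀; (□₁,Y₁),…,(□ₘ,Yₘ))` with a non-zero term is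
connected (✓`g3cWalk_conn_of_ne_zero`: `□_{i−1} ∈ Y_i`, `Y_i ∩ □̃_i ≠ ∅`) and its localization has `d_j(X) ≤ d_j(□̃₀) + Σ_i (d_j(Y_i) + d_j(□̃_i) + 4)` (✓`torusTreeLen_g3cWalkLoc_le_of_ne_zero`),
so the target rate `e^{−κt d_j(X)}` is paid by a factor `e^{κt(d_j(Y_i) + 9^d + 3)}` per step; each step matrix is bounded AT THE PAIR by `g3cStepBd` (far: `c e^{−δ₀ d_j(Y)}/γ`,
✓`l2_opNorm_g3cStep_le_far_of_pt`; near: `× 3^8·12(L·Mc)^4·e^{−κ′·L·Mc}·2`, ✓`l2_opNorm_g3cStep_le_near_of_pt` via ✓`one_le_torusTreeLen_or_avoids_tblock`); the sum over walks rooted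
at `□₀ ∈ X` of the products of the weights `g3cStepWt(□_{i−1}; □_i, Y_i)` is at most `Λ^m` for any `Λ` bounding the one-step sums `Σ_s g3cStepWt(a; s)` (path-sum lemma, induction on `m`).
The explicit `Λ(c, γ, δ₀, κ′, κt, Mc)` and the thresholds `δG`, `Mth'` making `Λ ≤ ½` are the next file.

WHAT THIS FILE PROVES (sorry-free): generic `G3CInv.pathPred` + ★`G3CInv.sum_prod_pathPred_le`; `dom_step_subset_g3cWalkLoc`; definitions `g3cStepBd`, `g3cStepWt` (+ nonnegativity);
★`norm_g3cStepM_le_bd`; ★`norm_g3cWalkTerm_le_wt`; ★★`sum_norm_g3cWalkTerm_le` and `norm_g3cWm_le` (`|W_m(X)(x,φ)| ≤ (N_□/γ)·e^{κt·9^d}·#X·e^{−κt d_j(X)}·Λ^m`).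

HONEST FRAMING.  Combinatorics and elementary estimates under point hypotheses (asserted for nothing); nothing of Bałaban asserted, ported or discharged; `stub_G3C` NOT closed; 27930 OPEN;
NODE O 0∕1; COUNT 8∕28 · K 1∕4 UNMOVED; finite `𝕋⁴_{L^K}` at fixed ε — NOT continuum ∕ OS ∕ Clay; **the Yang–Mills mass gap is NOT proved by any of this.**  No `sorry`, no `instance`, no
`notation`; standard axioms.
-/

noncomputable section

open scoped BigOperators Matrix.Norms.L2Operator Topology Matrix Classical
open Filter Finset

namespace Summit.QuantumFields.YangMills.Theorems.BalabanUVNodesPortS1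

open Summit.QuantumFields.YangMills.Theorems.K0RecordFormatNames
open Literature.MathematicalPhysics.QuantumFieldTheory.Balaban1983to89
open Literature.MathematicalPhysics.QuantumFieldTheory.Balaban1983to89.Node00
open Literature.MathematicalPhysics.QuantumFieldTheory.Balaban1983to89.T4Continuum (T4Family)
open Literature.MathematicalPhysics.QuantumFieldTheory.Balaban1983to89.TreeLengthTorus (TPt IsTDom TFaceConnected torusTreeLen torusTreeLen_nonneg)
open Literature.MathematicalPhysics.QuantumFieldTheory.Balaban1983to89.TreeLengthTorusTransfer (tblock tcollar)
open Literature.MathematicalPhysics.QuantumFieldTheory.Balaban1983to89.B12TreeDecay (K₀ kappa₀)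
open Literature.MathematicalPhysics.QuantumFieldTheory.Balaban1983to89.B5Prop11Lower (nsq nsq_nonneg)

/-! ## §0  Generic: the path-sum lemma -/

namespace G3CInv

variable {α σ : Type*}

/-- **The predecessor of step `i` of a walk**: the root `a` for `i = 0`, else `next (w (i−1))`. [cite: Balaban1985BackgroundPropagators, (3.90) p.409 (random walks)] -/
def pathPred (next : σ → α) (a : α) {m : ℕ} (w : Fin m → σ) (i : Fin m) : α :=
  if h : i.val = 0 then a else next (w ⟨i.val - 1, by omega⟩)

/-- The predecessor of the first step of `s :: w` is the root. [folklore] -/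
theorem pathPred_cons_zero (next : σ → α) (a : α) {m : ℕ} (s : σ) (w : Fin m → σ) :
    pathPred next a (Fin.cons s w : Fin (m + 1) → σ) 0 = a := by
  simp [pathPred]

/-- The predecessor of step `i+1` of `s :: w` is the predecessor of step `i` of `w` rooted at `next s`. [folklore] -/
theorem pathPred_cons_succ (next : σ → α) (a : α) {m : ℕ} (s : σ) (w : Fin m → σ) (i : Fin m) :
    pathPred next a (Fin.cons s w : Fin (m + 1) → σ) i.succ = pathPred next (next s) w i := by
  unfold pathPred
  rw [dif_neg (by simp : ¬ ((i.succ : Fin (m + 1)) : ℕ) = 0)]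
  by_cases h : i.val = 0
  · rw [dif_pos h]
    congr 1
    calc (Fin.cons s w : Fin (m + 1) → σ) ⟨((i.succ : Fin (m + 1)) : ℕ) - 1, by have := i.isLt; simp only [Fin.val_succ]; omega⟩
        = (Fin.cons s w : Fin (m + 1) → σ) 0 := congrArg (Fin.cons s w : Fin (m + 1) → σ) (Fin.ext (by simp [h]))
      _ = s := rfl
  · rw [dif_neg h]
    congr 1
    calc (Fin.cons s w : Fin (m + 1) → σ) ⟨((i.succ : Fin (m + 1)) : ℕ) - 1, by have := i.isLt; simp only [Fin.val_succ]; omega⟩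
        = (Fin.cons s w : Fin (m + 1) → σ) (⟨i.val - 1, by omega⟩ : Fin m).succ :=
          congrArg (Fin.cons s w : Fin (m + 1) → σ) (Fin.ext (by have := i.isLt; simp only [Fin.val_succ]; omega))
      _ = w ⟨i.val - 1, by omega⟩ := by simp only [Fin.cons_succ]

/-- ★ **THE PATH-SUM LEMMA**: if `f ≥ 0` and every one-step sum `Σ_s f(a; s)` is `≤ Λ`, then `Σ_{w : Fin m → σ} Π_i f(pred_i(w); w_i) ≤ Λ^m` (peel the first step, induct).
[cite: Balaban1985BackgroundPropagators, (3.96) p.411; Balaban1985UV3, (25) p.262] -/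
theorem sum_prod_pathPred_le [Fintype σ] (next : σ → α) (f : α → σ → ℝ) (hf : ∀ a s, 0 ≤ f a s) {Λ : ℝ} (hΛ : ∀ a, ∑ s, f a s ≤ Λ) :
    ∀ (m : ℕ) (a : α), ∑ w : Fin m → σ, ∏ i : Fin m, f (pathPred next a w i) (w i) ≤ Λ ^ m := by
  intro m
  induction m with
  | zero => intro a; simp
  | succ m ih =>
      intro a
      rw [sum_fin_succ_cons m (fun w : Fin (m + 1) → σ => ∏ i : Fin (m + 1), f (pathPred next a w i) (w i))]
      have hstep : ∀ s : σ, ∑ w : Fin m → σ, ∏ i : Fin (m + 1), f (pathPred next a (Fin.cons s w) i) ((Fin.cons s w : Fin (m + 1) → σ) i) =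
          f a s * ∑ w : Fin m → σ, ∏ i : Fin m, f (pathPred next (next s) w i) (w i) := by
        intro s
        rw [Finset.mul_sum]
        refine Finset.sum_congr rfl fun w _ => ?_
        rw [Fin.prod_univ_succ, pathPred_cons_zero, Fin.cons_zero]
        refine congrArg (f a s * ·) (Finset.prod_congr rfl fun i _ => ?_)
        rw [pathPred_cons_succ, Fin.cons_succ]
      have hΛ0 : 0 ≤ Λ := le_trans (Finset.sum_nonneg fun s _ => hf a s) (hΛ a)
      calc ∑ s, ∑ w : Fin m → σ, ∏ i : Fin (m + 1), f (pathPred next a (Fin.cons s w) i) ((Fin.cons s w : Fin (m + 1) → σ) i)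
          = ∑ s, f a s * ∑ w : Fin m → σ, ∏ i : Fin m, f (pathPred next (next s) w i) (w i) := Finset.sum_congr rfl fun s _ => hstep s
        _ ≤ ∑ s, f a s * Λ ^ m := Finset.sum_le_sum fun s _ => mul_le_mul_of_nonneg_left (ih (next s)) (hf a s)
        _ = (∑ s, f a s) * Λ ^ m := by rw [Finset.sum_mul]
        _ ≤ Λ * Λ ^ m := mul_le_mul_of_nonneg_right (hΛ a) (pow_nonneg hΛ0 m)
        _ = Λ ^ (m + 1) := by ring

end G3CInv

/-! ## §1  The step domains lie in the localization -/

section Geom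

variable {F : T4Family}

/-- `Y_i ⊆ X(□₀, w)`. [folklore] -/
theorem dom_step_subset_g3cWalkLoc (Mc k K : ℕ) (q₀ : TPt (F.P K).d (Sect2.domCount (F.P K) Mc (k + 1))) {m : ℕ}
    (w : Fin m → TPt (F.P K).d (Sect2.domCount (F.P K) Mc (k + 1)) × (recordDomSys F Mc k K).Dom) (i : Fin m) :
    ((w i).2.1 : Finset _) ⊆ g3cWalkLoc F Mc k K q₀ w := by
  intro c hc
  rw [g3cWalkLoc, Finset.mem_union, Finset.mem_biUnion]
  exact Or.inr ⟨i, Finset.mem_univ _, Finset.mem_union.2 (Or.inl hc)⟩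

end Geom

/-! ## §2  The step bound and the step weight -/

section Defs

variable (F : T4Family)

/-- **The step bound `b(□, Y)`**: `0` if `Y ⊆ □̃` (no such step), the FAR bound `c·e^{−δ₀d_j(Y)}/γ` if `d_j(Y) ≥ 1`, else the NEAR bound `c·e^{−δ₀d_j(Y)}·3^8·12(L·Mc)^4·e^{−κ′·L·Mc}/(γ/2)`.
[cite: Balaban1985BackgroundPropagators, (3.89) p.409, (3.94) p.410; Balaban1985UV3, (23) p.262] -/
def g3cStepBd (Mc k K : ℕ) (c γ δ₀ κ' : ℝ) (s : TPt (F.P K).d (Sect2.domCount (F.P K) Mc (k + 1)) × (recordDomSys F Mc k K).Dom) : ℝ :=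
  if (s.2.1 : Finset _) ⊆ (g3cBlk F Mc k K s.1).1 then 0
  else if 1 ≤ (recordDomSys F Mc k K).dj s.2 then c * Real.exp (-(δ₀ * (recordDomSys F Mc k K).dj s.2)) * (1 / γ)
  else c * Real.exp (-(δ₀ * (recordDomSys F Mc k K).dj s.2)) *
    ((3 ^ 4 * 3 ^ 4 * (3 * 4 * (F.L * Mc) ^ 4) : ℕ) * (Real.exp (-(κ' * ((F.L * Mc : ℕ) : ℝ))) / (γ / 2)))

/-- **The step weight `f(a; □, Y)`** of the path sum: the indicators of `a ∈ Y` and `Y ∩ □̃ ≠ ∅` (connectedness of non-vanishing walks), the step bound, and the rate-transfer factor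
`e^{κt·(d_j(Y) + 9^d + 3)}`. [cite: Balaban1985UV3, (25) p.262; Balaban1988RG2Cluster, (2.27) p.18] -/
def g3cStepWt (Mc k K : ℕ) (c γ δ₀ κ' κt : ℝ) (a : TPt (F.P K).d (Sect2.domCount (F.P K) Mc (k + 1)))
    (s : TPt (F.P K).d (Sect2.domCount (F.P K) Mc (k + 1)) × (recordDomSys F Mc k K).Dom) : ℝ :=
  (if a ∈ (s.2.1 : Finset _) then (1 : ℝ) else 0) * (if ((s.2.1 : Finset _) ∩ (g3cBlk F Mc k K s.1).1).Nonempty then (1 : ℝ) else 0) *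
    (g3cStepBd F Mc k K c γ δ₀ κ' s * Real.exp (κt * ((recordDomSys F Mc k K).dj s.2 + ((3 ^ (F.P K).d * 3 ^ (F.P K).d : ℕ) + 3))))

variable {F}

/-- `0 ≤ b(s)`. [folklore] -/
theorem g3cStepBd_nonneg (Mc k K : ℕ) {c γ : ℝ} (δ₀ κ' : ℝ) (hc : 0 ≤ c) (hγ : 0 < γ)
    (s : TPt (F.P K).d (Sect2.domCount (F.P K) Mc (k + 1)) × (recordDomSys F Mc k K).Dom) : 0 ≤ g3cStepBd F Mc k K c γ δ₀ κ' s := by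
  unfold g3cStepBd
  split_ifs <;> positivity

/-- `0 ≤ f(a; s)`. [folklore] -/
theorem g3cStepWt_nonneg (Mc k K : ℕ) {c γ : ℝ} (δ₀ κ' κt : ℝ) (hc : 0 ≤ c) (hγ : 0 < γ) (a : TPt (F.P K).d (Sect2.domCount (F.P K) Mc (k + 1)))
    (s : TPt (F.P K).d (Sect2.domCount (F.P K) Mc (k + 1)) × (recordDomSys F Mc k K).Dom) : 0 ≤ g3cStepWt F Mc k K c γ δ₀ κ' κt a s := by
  unfold g3cStepWt
  have := g3cStepBd_nonneg (F := F) Mc k K δ₀ κ' hc hγ s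
  refine mul_nonneg (mul_nonneg ?_ ?_) (by positivity) <;> split_ifs <;> norm_num

end Defs

/-! ## §3  The step matrices and the walk terms at a pair of `G3CPt` -/

section Pair

variable {F : T4Family}
variable {a₀ δ₀ c₀ γ₀ γ₁ δ₁ : ℝ} {Mc : ℕ} {α₀ α₁ ε₂₉ : ℝ} {k : ℕ}
variable {TC : (n : ℕ) → Sect2.CPair (F.P (recordK₀ F Mc k + n)) (MatA 2) → FluctIdx F k (recordK₀ F Mc k + n) → FluctIdx F k (recordK₀ F Mc k + n) → ℂ}
variable {TY : (n : ℕ) → (recordDomSys F Mc k (recordK₀ F Mc k + n)).Dom → Sect2.CPair (F.P (recordK₀ F Mc k + n)) (MatA 2) →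
  FluctIdx F k (recordK₀ F Mc k + n) → FluctIdx F k (recordK₀ F Mc k + n) → ℂ}
variable {TZY : Finset (Fin 4 → ℤ) → IntBondCfg → ((Fin 4 → ℤ) × Fin 4) × Fin 3 → ((Fin 4 → ℤ) × Fin 4) × Fin 3 → ℂ}
variable {AdM : (n : ℕ) → (Site (F.P (recordK₀ F Mc k + n)) 0 → (MatA 2)ˣ) →
  Matrix (FluctIdx F k (recordK₀ F Mc k + n)) (FluctIdx F k (recordK₀ F Mc k + n)) ℂ}
variable {AdZ : ((Fin 4 → ℤ) → (MatA 2)ˣ) → (Fin 4 → ℤ) × Fin 4 → Matrix (Fin 3) (Fin 3) ℂ}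

/-- ★ **EVERY ADMISSIBLE STEP MATRIX IS BOUNDED BY THE STEP BOUND AT THE PAIR**: `‖S^M_{□,Y}(x, φ)‖ ≤ b(□, Y)` whenever `Y ⊆ X`, `□̃ ⊆ X` and `G3CPt … c γ δ₀ δ₁ X φ` (far ∕ near
dichotomy ✓`one_le_torusTreeLen_or_avoids_tblock`). [cite: Balaban1985BackgroundPropagators, (3.89) p.409, (3.94) p.410; Balaban1985UV3, (23) p.262] -/
theorem norm_g3cStepM_le_bd (hP : P0CarrierClauses F a₀ δ₀ c₀ γ₀ γ₁ Mc α₀ α₁ ε₂₉ k TC TY TZY AdM AdZ) (hMc : McGuard F Mc) {c γ δ₁' κ' : ℝ} (hc : 0 ≤ c)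
    (hγ : 0 < γ) (hδ₁ : 0 < δ₁') (hδ₀ : kappa₀ (4 * 2 ^ 4) (2 * 4) ≤ δ₀) (hκ : 0 ≤ κ') (hκδ : 2 * κ' ≤ δ₁') (hκc : 4 * κ' * (c * K₀ (4 * 2 ^ 4) (2 * 4)) ≤ γ * δ₁')
    (n : ℕ) {X : (recordDomSys F Mc k (recordK₀ F Mc k + n)).Dom} {φ : Sect2.CPair (F.P (recordK₀ F Mc k + n)) (MatA 2)}
    (hpt : G3CPt F Mc k (recordK₀ F Mc k + n) (TY n) c γ δ₀ δ₁' X φ) {x : ℝ} (hx : 0 ≤ x)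
    (s : TPt (F.P (recordK₀ F Mc k + n)).d (Sect2.domCount (F.P (recordK₀ F Mc k + n)) Mc (k + 1)) × (recordDomSys F Mc k (recordK₀ F Mc k + n)).Dom)
    (hY : (s.2.1 : Finset _) ⊆ X.1) (hB : ((g3cBlk F Mc k (recordK₀ F Mc k + n) s.1).1 : Finset _) ⊆ X.1) :
    ‖g3cStepM F Mc k (recordK₀ F Mc k + n) (TY n) x φ s‖ ≤ g3cStepBd F Mc k (recordK₀ F Mc k + n) c γ δ₀ κ' s := by
  rw [g3cStepM, g3cStepBd]
  by_cases hsub : (s.2.1 : Finset _) ⊆ (g3cBlk F Mc k (recordK₀ F Mc k + n) s.1).1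
  · rw [if_pos hsub, if_pos hsub, norm_zero]
  rw [if_neg hsub, if_neg hsub]
  have hrows := (hpt.1 s.2 hY).1
  have hcols := (hpt.1 s.2 hY).2
  have hco := hpt.2 (g3cBlk F Mc k (recordK₀ F Mc k + n) s.1) hB
  by_cases hfar : 1 ≤ (recordDomSys F Mc k (recordK₀ F Mc k + n)).dj s.2
  · rw [if_pos hfar]
    exact l2_opNorm_g3cStep_le_far_of_pt hc hγ hδ₁.le n s.1 s.2 hrows hcols hco hx
  · rw [if_neg hfar]
    have havoid : ∀ c ∈ (s.2.1 : Finset _), c ∉ tblock s.1 := by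
      rcases G3CGeom.one_le_torusTreeLen_or_avoids_tblock s.2.2.2 (q := s.1) hsub with h1 | h2
      · exact absurd h1 hfar
      · exact h2
    have hG := norm_g3cLocInv_apply_le_exp_of_pt hP hMc hc hγ hδ₁ hδ₀ hκ hκδ hκc n (g3cBlk F Mc k (recordK₀ F Mc k + n) s.1)
      (fun Y' hY' => hpt.1 Y' (hY'.trans hB)) hco hx
    exact l2_opNorm_g3cStep_le_near_of_pt hP hMc hc hγ hδ₁.le hκ n s.1 s.2 havoid hrows hcols hG

/-- ★ **THE WALK TERM AGAINST THE STEP WEIGHTS, WITH THE TARGET RATE EXTRACTED**: for a walk with localization `X` at a pair of `G3CPt … X φ`, `x ≥ 0`, `κt ≥ 0`: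
`|t(□₀, w)| ≤ (N_□/γ)·e^{κt·9^d}·e^{−κt·d_j(X)}·Π_i f(□_{i−1}; □_i, Y_i)`. [cite: Balaban1985UV3, (25) p.262; Balaban1988RG2Cluster, (2.27) p.18; Balaban1985BackgroundPropagators, (3.96) p.411] -/
theorem norm_g3cWalkTerm_le_wt (hP : P0CarrierClauses F a₀ δ₀ c₀ γ₀ γ₁ Mc α₀ α₁ ε₂₉ k TC TY TZY AdM AdZ) (hMc : McGuard F Mc) {c γ δ₁' κ' κt : ℝ} (hc : 0 ≤ c)
    (hγ : 0 < γ) (hδ₁ : 0 < δ₁') (hδ₀ : kappa₀ (4 * 2 ^ 4) (2 * 4) ≤ δ₀) (hκ : 0 ≤ κ') (hκδ : 2 * κ' ≤ δ₁') (hκc : 4 * κ' * (c * K₀ (4 * 2 ^ 4) (2 * 4)) ≤ γ * δ₁')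
    (hκt : 0 ≤ κt) (n : ℕ) {X : (recordDomSys F Mc k (recordK₀ F Mc k + n)).Dom} {φ : Sect2.CPair (F.P (recordK₀ F Mc k + n)) (MatA 2)}
    (hpt : G3CPt F Mc k (recordK₀ F Mc k + n) (TY n) c γ δ₀ δ₁' X φ) {x : ℝ} (hx : 0 ≤ x)
    (q₀ : TPt (F.P (recordK₀ F Mc k + n)).d (Sect2.domCount (F.P (recordK₀ F Mc k + n)) Mc (k + 1))) {m : ℕ}
    (w : Fin m → TPt (F.P (recordK₀ F Mc k + n)).d (Sect2.domCount (F.P (recordK₀ F Mc k + n)) Mc (k + 1)) × (recordDomSys F Mc k (recordK₀ F Mc k + n)).Dom)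
    (hloc : g3cWalkLoc F Mc k (recordK₀ F Mc k + n) q₀ w = X.1) :
    ‖g3cWalkTerm F Mc k (recordK₀ F Mc k + n) (TY n) x φ q₀ w‖ ≤
      (3 * (F.P (recordK₀ F Mc k + n)).d * (F.L * Mc) ^ (F.P (recordK₀ F Mc k + n)).d : ℕ) * (1 / γ) *
        Real.exp (κt * ((3 ^ (F.P (recordK₀ F Mc k + n)).d * 3 ^ (F.P (recordK₀ F Mc k + n)).d : ℕ) : ℝ)) *
        Real.exp (-(κt * (recordDomSys F Mc k (recordK₀ F Mc k + n)).dj X)) *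
        ∏ i : Fin m, g3cStepWt F Mc k (recordK₀ F Mc k + n) c γ δ₀ κ' κt (G3CInv.pathPred Prod.fst q₀ w i) (w i) := by
  -- abbreviations
  have hwt0 : ∀ i, 0 ≤ g3cStepWt F Mc k (recordK₀ F Mc k + n) c γ δ₀ κ' κt (G3CInv.pathPred Prod.fst q₀ w i) (w i) :=
    fun i => g3cStepWt_nonneg Mc k _ δ₀ κ' κt hc hγ _ _
  by_cases ht : g3cWalkTerm F Mc k (recordK₀ F Mc k + n) (TY n) x φ q₀ w = 0
  · rw [ht, norm_zero]
    exact mul_nonneg (by positivity) (Finset.prod_nonneg fun i _ => hwt0 i)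
  obtain ⟨h0, hcn, hb⟩ := g3cWalk_conn_of_ne_zero hP hMc n x φ q₀ w ht
  have htree := torusTreeLen_g3cWalkLoc_le_of_ne_zero hP hMc n x φ q₀ w ht
  rw [hloc] at htree
  -- containments
  have hB0 : ((g3cBlk F Mc k (recordK₀ F Mc k + n) q₀).1 : Finset _) ⊆ X.1 := hloc ▸ blk_subset_g3cWalkLoc Mc k _ q₀ w
  have hYi : ∀ i, ((w i).2.1 : Finset _) ⊆ X.1 := fun i => hloc ▸ dom_step_subset_g3cWalkLoc Mc k _ q₀ w i
  have hBi : ∀ i, ((g3cBlk F Mc k (recordK₀ F Mc k + n) (w i).1).1 : Finset _) ⊆ X.1 := fun i => hloc ▸ blk_step_subset_g3cWalkLoc Mc k _ q₀ w i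
  -- (A) the rooted trace bound
  have hA := norm_g3cWalkTerm_le_of_coer hMc hγ n q₀ (hpt.2 _ hB0) hx w
  -- (B) the step bounds
  have hB : ∏ i : Fin m, ‖g3cStepM F Mc k (recordK₀ F Mc k + n) (TY n) x φ (w i)‖ ≤ ∏ i : Fin m, g3cStepBd F Mc k (recordK₀ F Mc k + n) c γ δ₀ κ' (w i) :=
    Finset.prod_le_prod (fun i _ => norm_nonneg _) fun i _ => norm_g3cStepM_le_bd hP hMc hc hγ hδ₁ hδ₀ hκ hκδ hκc n hpt hx (w i) (hYi i) (hBi i)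
  -- (C) the rate transfer
  set CB : ℝ := ((3 ^ (F.P (recordK₀ F Mc k + n)).d * 3 ^ (F.P (recordK₀ F Mc k + n)).d : ℕ) : ℝ) with hCB
  have hexp : 1 ≤ Real.exp (κt * CB) * Real.exp (-(κt * (recordDomSys F Mc k (recordK₀ F Mc k + n)).dj X)) *
      ∏ i : Fin m, Real.exp (κt * ((recordDomSys F Mc k (recordK₀ F Mc k + n)).dj (w i).2 + (CB + 3))) := by
    rw [← Real.exp_sum, ← Real.exp_add, ← Real.exp_add]
    apply Real.one_le_exp
    have hblk : ∀ q : TPt (F.P (recordK₀ F Mc k + n)).d (Sect2.domCount (F.P (recordK₀ F Mc k + n)) Mc (k + 1)),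
        torusTreeLen ((g3cBlk F Mc k (recordK₀ F Mc k + n) q).1 : Finset _) ≤ CB - 1 := fun q => torusTreeLen_g3cBlk_le Mc k _ q
    have hsum : ∑ i : Fin m, (torusTreeLen (((w i).2.1 : Finset _)) + torusTreeLen ((g3cBlk F Mc k (recordK₀ F Mc k + n) (w i).1).1 : Finset _) + 4) ≤
        ∑ i : Fin m, ((recordDomSys F Mc k (recordK₀ F Mc k + n)).dj (w i).2 + (CB + 3)) := by
      refine Finset.sum_le_sum fun i _ => ?_
      have := hblk (w i).1
      show torusTreeLen (((w i).2.1 : Finset _)) + torusTreeLen ((g3cBlk F Mc k (recordK₀ F Mc k + n) (w i).1).1 : Finset _) + 4 ≤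
        torusTreeLen (((w i).2.1 : Finset _)) + (CB + 3)
      linarith
    have hX : torusTreeLen (X.1 : Finset _) ≤ CB + ∑ i : Fin m, ((recordDomSys F Mc k (recordK₀ F Mc k + n)).dj (w i).2 + (CB + 3)) := by
      linarith [htree, hsum, hblk q₀]
    have hdj : (recordDomSys F Mc k (recordK₀ F Mc k + n)).dj X = torusTreeLen (X.1 : Finset _) := rfl
    rw [hdj]
    have hm : ∑ i : Fin m, κt * ((recordDomSys F Mc k (recordK₀ F Mc k + n)).dj (w i).2 + (CB + 3)) =
        κt * ∑ i : Fin m, ((recordDomSys F Mc k (recordK₀ F Mc k + n)).dj (w i).2 + (CB + 3)) := by rw [Finset.mul_sum]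
    rw [hm]
    have := mul_nonneg hκt (sub_nonneg.2 hX)
    linarith
  -- (D) the indicators are `1` on a connected walk
  have hD : ∏ i : Fin m, g3cStepWt F Mc k (recordK₀ F Mc k + n) c γ δ₀ κ' κt (G3CInv.pathPred Prod.fst q₀ w i) (w i) =
      ∏ i : Fin m, (g3cStepBd F Mc k (recordK₀ F Mc k + n) c γ δ₀ κ' (w i) * Real.exp (κt * ((recordDomSys F Mc k (recordK₀ F Mc k + n)).dj (w i).2 + (CB + 3)))) := by
    refine Finset.prod_congr rfl fun i _ => ?_
    have hpred : G3CInv.pathPred Prod.fst q₀ w i ∈ ((w i).2.1 : Finset _) := by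
      unfold G3CInv.pathPred
      by_cases hi : i.val = 0
      · rw [dif_pos hi]; exact h0 i hi
      · rw [dif_neg hi]; exact hcn ⟨i.val - 1, by omega⟩ i (by simp; omega)
    have hmeet : (((w i).2.1 : Finset _) ∩ (g3cBlk F Mc k (recordK₀ F Mc k + n) (w i).1).1).Nonempty := by
      obtain ⟨c', hc1, hc2⟩ := hb i
      exact ⟨c', Finset.mem_inter.2 ⟨hc1, hc2⟩⟩
    rw [g3cStepWt, if_pos hpred, if_pos hmeet, one_mul, one_mul]
  -- assemble
  have hN0 : 0 ≤ ((3 * (F.P (recordK₀ F Mc k + n)).d * (F.L * Mc) ^ (F.P (recordK₀ F Mc k + n)).d : ℕ) : ℝ) * (1 / γ) := by positivity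
  have hprod0 : 0 ≤ ∏ i : Fin m, g3cStepBd F Mc k (recordK₀ F Mc k + n) c γ δ₀ κ' (w i) :=
    Finset.prod_nonneg fun i _ => g3cStepBd_nonneg Mc k _ δ₀ κ' hc hγ _
  rw [hD, Finset.prod_mul_distrib]
  calc ‖g3cWalkTerm F Mc k (recordK₀ F Mc k + n) (TY n) x φ q₀ w‖
      ≤ ((3 * (F.P (recordK₀ F Mc k + n)).d * (F.L * Mc) ^ (F.P (recordK₀ F Mc k + n)).d : ℕ) : ℝ) * (1 / γ) *
          ∏ i : Fin m, g3cStepBd F Mc k (recordK₀ F Mc k + n) c γ δ₀ κ' (w i) := hA.trans (mul_le_mul_of_nonneg_left hB hN0)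
    _ = ((3 * (F.P (recordK₀ F Mc k + n)).d * (F.L * Mc) ^ (F.P (recordK₀ F Mc k + n)).d : ℕ) : ℝ) * (1 / γ) *
          (∏ i : Fin m, g3cStepBd F Mc k (recordK₀ F Mc k + n) c γ δ₀ κ' (w i)) * 1 := by rw [mul_one]
    _ ≤ ((3 * (F.P (recordK₀ F Mc k + n)).d * (F.L * Mc) ^ (F.P (recordK₀ F Mc k + n)).d : ℕ) : ℝ) * (1 / γ) *
          (∏ i : Fin m, g3cStepBd F Mc k (recordK₀ F Mc k + n) c γ δ₀ κ' (w i)) *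
          (Real.exp (κt * CB) * Real.exp (-(κt * (recordDomSys F Mc k (recordK₀ F Mc k + n)).dj X)) *
            ∏ i : Fin m, Real.exp (κt * ((recordDomSys F Mc k (recordK₀ F Mc k + n)).dj (w i).2 + (CB + 3)))) :=
        mul_le_mul_of_nonneg_left hexp (mul_nonneg hN0 hprod0)
    _ = _ := by ring

/-- ★★ **THE SUM OVER WALKS WITH LOCALIZATION `X`**: at a pair of `G3CPt … X φ`, for `x ≥ 0` and any `Λ` bounding the one-step sums of the weight,
`Σ_{□₀} Σ_{w : |w| = m} 𝟙[X(□₀,w) = X]·|t(□₀,w)| ≤ (N_□/γ)·e^{κt·9^d}·#X·e^{−κt·d_j(X)}·Λ^m`. [cite: Balaban1985UV3, (25) p.262; Balaban1985BackgroundPropagators, (3.96) p.411] -/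
theorem sum_norm_g3cWalkTerm_le (hP : P0CarrierClauses F a₀ δ₀ c₀ γ₀ γ₁ Mc α₀ α₁ ε₂₉ k TC TY TZY AdM AdZ) (hMc : McGuard F Mc) {c γ δ₁' κ' κt : ℝ} (hc : 0 ≤ c)
    (hγ : 0 < γ) (hδ₁ : 0 < δ₁') (hδ₀ : kappa₀ (4 * 2 ^ 4) (2 * 4) ≤ δ₀) (hκ : 0 ≤ κ') (hκδ : 2 * κ' ≤ δ₁') (hκc : 4 * κ' * (c * K₀ (4 * 2 ^ 4) (2 * 4)) ≤ γ * δ₁')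
    (hκt : 0 ≤ κt) (n : ℕ) {X : (recordDomSys F Mc k (recordK₀ F Mc k + n)).Dom} {φ : Sect2.CPair (F.P (recordK₀ F Mc k + n)) (MatA 2)}
    (hpt : G3CPt F Mc k (recordK₀ F Mc k + n) (TY n) c γ δ₀ δ₁' X φ) {x : ℝ} (hx : 0 ≤ x) (m : ℕ) {Λ : ℝ}
    (hΛ : ∀ a, ∑ s, g3cStepWt F Mc k (recordK₀ F Mc k + n) c γ δ₀ κ' κt a s ≤ Λ) :
    ∑ q₀ : TPt (F.P (recordK₀ F Mc k + n)).d (Sect2.domCount (F.P (recordK₀ F Mc k + n)) Mc (k + 1)),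
      ∑ w : Fin m → TPt (F.P (recordK₀ F Mc k + n)).d (Sect2.domCount (F.P (recordK₀ F Mc k + n)) Mc (k + 1)) × (recordDomSys F Mc k (recordK₀ F Mc k + n)).Dom,
        (if g3cWalkLoc F Mc k (recordK₀ F Mc k + n) q₀ w = X.1 then ‖g3cWalkTerm F Mc k (recordK₀ F Mc k + n) (TY n) x φ q₀ w‖ else 0) ≤
      (3 * (F.P (recordK₀ F Mc k + n)).d * (F.L * Mc) ^ (F.P (recordK₀ F Mc k + n)).d : ℕ) * (1 / γ) *
        Real.exp (κt * ((3 ^ (F.P (recordK₀ F Mc k + n)).d * 3 ^ (F.P (recordK₀ F Mc k + n)).d : ℕ) : ℝ)) *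
        ((X.1 : Finset _).card : ℝ) * Real.exp (-(κt * (recordDomSys F Mc k (recordK₀ F Mc k + n)).dj X)) * Λ ^ m := by
  set C : ℝ := (3 * (F.P (recordK₀ F Mc k + n)).d * (F.L * Mc) ^ (F.P (recordK₀ F Mc k + n)).d : ℕ) * (1 / γ) *
        Real.exp (κt * ((3 ^ (F.P (recordK₀ F Mc k + n)).d * 3 ^ (F.P (recordK₀ F Mc k + n)).d : ℕ) : ℝ)) *
        Real.exp (-(κt * (recordDomSys F Mc k (recordK₀ F Mc k + n)).dj X)) with hCdef
  have hC0 : 0 ≤ C := by positivity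
  have hwt0 : ∀ a s, 0 ≤ g3cStepWt F Mc k (recordK₀ F Mc k + n) c γ δ₀ κ' κt a s := fun a s => g3cStepWt_nonneg Mc k _ δ₀ κ' κt hc hγ a s
  have hΛ0 : 0 ≤ Λ := by
    obtain ⟨a⟩ : Nonempty (TPt (F.P (recordK₀ F Mc k + n)).d (Sect2.domCount (F.P (recordK₀ F Mc k + n)) Mc (k + 1))) := ⟨fun _ => 0⟩
    exact le_trans (Finset.sum_nonneg fun s _ => hwt0 a s) (hΛ a)
  have hpath := G3CInv.sum_prod_pathPred_le Prod.fst (g3cStepWt F Mc k (recordK₀ F Mc k + n) c γ δ₀ κ' κt) hwt0 hΛ m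
  -- each root contributes at most `C·Λ^m`, and only roots in `X` contribute
  have hroot : ∀ q₀ : TPt (F.P (recordK₀ F Mc k + n)).d (Sect2.domCount (F.P (recordK₀ F Mc k + n)) Mc (k + 1)),
      ∑ w : Fin m → TPt (F.P (recordK₀ F Mc k + n)).d (Sect2.domCount (F.P (recordK₀ F Mc k + n)) Mc (k + 1)) × (recordDomSys F Mc k (recordK₀ F Mc k + n)).Dom,
        (if g3cWalkLoc F Mc k (recordK₀ F Mc k + n) q₀ w = X.1 then ‖g3cWalkTerm F Mc k (recordK₀ F Mc k + n) (TY n) x φ q₀ w‖ else 0) ≤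
        if q₀ ∈ (X.1 : Finset _) then C * Λ ^ m else 0 := by
    intro q₀
    by_cases hq : q₀ ∈ (X.1 : Finset _)
    · rw [if_pos hq]
      calc ∑ w : Fin m → TPt (F.P (recordK₀ F Mc k + n)).d (Sect2.domCount (F.P (recordK₀ F Mc k + n)) Mc (k + 1)) × (recordDomSys F Mc k (recordK₀ F Mc k + n)).Dom,
            (if g3cWalkLoc F Mc k (recordK₀ F Mc k + n) q₀ w = X.1 then ‖g3cWalkTerm F Mc k (recordK₀ F Mc k + n) (TY n) x φ q₀ w‖ else 0)
          ≤ ∑ w : Fin m → TPt (F.P (recordK₀ F Mc k + n)).d (Sect2.domCount (F.P (recordK₀ F Mc k + n)) Mc (k + 1)) × (recordDomSys F Mc k (recordK₀ F Mc k + n)).Dom,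
              C * ∏ i : Fin m, g3cStepWt F Mc k (recordK₀ F Mc k + n) c γ δ₀ κ' κt (G3CInv.pathPred Prod.fst q₀ w i) (w i) := by
            refine Finset.sum_le_sum fun w _ => ?_
            split_ifs with hl
            · have := norm_g3cWalkTerm_le_wt hP hMc hc hγ hδ₁ hδ₀ hκ hκδ hκc hκt n hpt hx q₀ w hl
              rw [hCdef]; exact this
            · exact mul_nonneg hC0 (Finset.prod_nonneg fun i _ => hwt0 _ _)
        _ = C * ∑ w : Fin m → TPt (F.P (recordK₀ F Mc k + n)).d (Sect2.domCount (F.P (recordK₀ F Mc k + n)) Mc (k + 1)) × (recordDomSys F Mc k (recordK₀ F Mc k + n)).Dom,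
              ∏ i : Fin m, g3cStepWt F Mc k (recordK₀ F Mc k + n) c γ δ₀ κ' κt (G3CInv.pathPred Prod.fst q₀ w i) (w i) := by rw [Finset.mul_sum]
        _ ≤ C * Λ ^ m := mul_le_mul_of_nonneg_left (hpath q₀) hC0
    · rw [if_neg hq]
      refine (Finset.sum_eq_zero fun w _ => ?_).le
      rw [if_neg]
      intro hl
      exact hq (hl ▸ blk_subset_g3cWalkLoc Mc k _ q₀ w (mem_g3cBlk_self Mc k _ q₀))
  calc ∑ q₀, ∑ w : Fin m → TPt (F.P (recordK₀ F Mc k + n)).d (Sect2.domCount (F.P (recordK₀ F Mc k + n)) Mc (k + 1)) × (recordDomSys F Mc k (recordK₀ F Mc k + n)).Dom,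
        (if g3cWalkLoc F Mc k (recordK₀ F Mc k + n) q₀ w = X.1 then ‖g3cWalkTerm F Mc k (recordK₀ F Mc k + n) (TY n) x φ q₀ w‖ else 0)
      ≤ ∑ q₀ : TPt (F.P (recordK₀ F Mc k + n)).d (Sect2.domCount (F.P (recordK₀ F Mc k + n)) Mc (k + 1)), (if q₀ ∈ (X.1 : Finset _) then C * Λ ^ m else 0) :=
        Finset.sum_le_sum fun q₀ _ => hroot q₀
    _ = ((X.1 : Finset _).card : ℝ) * (C * Λ ^ m) := by
        rw [← Finset.sum_filter, Finset.filter_mem_eq_inter, Finset.univ_inter, Finset.sum_const, nsmul_eq_mul]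
    _ = _ := by rw [hCdef]; ring

/-- **`|W_m(X)(x, φ)| ≤ (N_□/γ)·e^{κt·9^d}·#X·e^{−κt·d_j(X)}·Λ^m`** at a pair of `G3CPt … X φ`. [cite: Balaban1985UV3, (25) p.262; Balaban1987RG1, (1.18) p.263] -/
theorem norm_g3cWm_le (hP : P0CarrierClauses F a₀ δ₀ c₀ γ₀ γ₁ Mc α₀ α₁ ε₂₉ k TC TY TZY AdM AdZ) (hMc : McGuard F Mc) {c γ δ₁' κ' κt : ℝ} (hc : 0 ≤ c)
    (hγ : 0 < γ) (hδ₁ : 0 < δ₁') (hδ₀ : kappa₀ (4 * 2 ^ 4) (2 * 4) ≤ δ₀) (hκ : 0 ≤ κ') (hκδ : 2 * κ' ≤ δ₁') (hκc : 4 * κ' * (c * K₀ (4 * 2 ^ 4) (2 * 4)) ≤ γ * δ₁')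
    (hκt : 0 ≤ κt) (n : ℕ) {X : (recordDomSys F Mc k (recordK₀ F Mc k + n)).Dom} {φ : Sect2.CPair (F.P (recordK₀ F Mc k + n)) (MatA 2)}
    (hpt : G3CPt F Mc k (recordK₀ F Mc k + n) (TY n) c γ δ₀ δ₁' X φ) {x : ℝ} (hx : 0 ≤ x) (m : ℕ) {Λ : ℝ}
    (hΛ : ∀ a, ∑ s, g3cStepWt F Mc k (recordK₀ F Mc k + n) c γ δ₀ κ' κt a s ≤ Λ) :
    ‖g3cWm F Mc k (recordK₀ F Mc k + n) (TY n) x φ m X‖ ≤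
      (3 * (F.P (recordK₀ F Mc k + n)).d * (F.L * Mc) ^ (F.P (recordK₀ F Mc k + n)).d : ℕ) * (1 / γ) *
        Real.exp (κt * ((3 ^ (F.P (recordK₀ F Mc k + n)).d * 3 ^ (F.P (recordK₀ F Mc k + n)).d : ℕ) : ℝ)) *
        ((X.1 : Finset _).card : ℝ) * Real.exp (-(κt * (recordDomSys F Mc k (recordK₀ F Mc k + n)).dj X)) * Λ ^ m := by
  refine le_trans ?_ (sum_norm_g3cWalkTerm_le hP hMc hc hγ hδ₁ hδ₀ hκ hκδ hκc hκt n hpt hx m hΛ)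
  rw [g3cWm]
  refine (norm_sum_le _ _).trans (Finset.sum_le_sum fun q₀ _ => (norm_sum_le _ _).trans (Finset.sum_le_sum fun w _ => ?_))
  split_ifs
  · exact le_rfl
  · rw [norm_zero]

end Pair

end Summit.QuantumFields.YangMills.Theorems.BalabanUVNodesPortS1

end
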